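import Summits.PneNP.PneNP.Theorems.SoloInformedIOShape
import Literature.Computability.MetaComplexity.OnesZeroPadRefuters
import HarnessLib

/-!
# `PneNP` is automatically constructive: the summit ⇔ polynomial-time refuters against every polynomial-time heuristic

Soloist file (`solo-PneNP-informed`; landing prefix `SoloInformed`). A third kernel-checked
SHARPENING OF THE SUMMIT STATEMENT; no progress toward `P ≠ NP` is claimed.

`SoloInformedIOShape` records that the summit is an infinitely-often obligation per machine:
`PneNP ↔ ∀ D ∈ P, {x | x ∈ SAT ↔ x ∉ D}` is infinite. Gutfreund–Shaltiel–Ta-Shma (2007) and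
Chen–Jin–Santhanam–Williams (Thm. 1.2, 2022) show that for `NP`-complete problems such error sets
are moreover EFFICIENTLY HIT: if `NP ⊄ P` then against every `D ∈ P` a polynomial-time procedure
prints, from `1ⁿ`, an instance on which `D` errs, for infinitely many `n` (tree:
`pConstructiveSeparation_of_not_NP_subset_P_holds`; the printed paddability hypothesis is
discharged in `Literature/Computability/MetaComplexity/OnesZeroPadRefuters.lean`). Read against the
summit this gives EQUIVALENCES:

* `soloInformed_pneNP_iff_hasPConstructiveSeparation` —
  `PneNP ↔ ∀ L, IsNPComplete L → IsLengthPaddable L → HasPConstructiveSeparation L P`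
  (exact-length `P`-refuters, Def. 1.1 of Chen et al.);
* `soloInformed_pneNP_iff_padSAT_refutable` — the same on the one language `onesZeroPad SAT`
  (`{1ⁱ 0 x : x ∈ SAT}`, length-paddable and `NP`-complete);
* `soloInformed_pneNP_iff_sat_refutable` — **`P ≠ NP` iff every polynomial-time heuristic for `SAT`
  is refuted infinitely often by a polynomial-time instance generator**: `PneNP ↔ ∀ D ∈ P, ∃ R`
  (polynomial time on `1ⁿ`, `|R n| ≤ n`) `∃ᶠ n, (R n ∈ SAT ↔ R n ∉ D)`;
* `soloInformed_pneNP_iff_sat_errors_infinite_and_constructible` — the two shapes side by side: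
  `PneNP ↔ ∀ D ∈ P`, the error set of `D` on `SAT` is infinite AND polynomial-time hit i.o.

So a proof of the summit must — and a proof of the summit automatically does — provide, for every
polynomial-time algorithm, an efficient adversary generating its counterexamples; what it need NOT
provide is a way to tell WHICH printed instance is the counterexample (the refuter's success is
itself an i.o., unverified event), nor counterexamples for non-complete languages: under
`NE ⊄ io-E` some language of `NP ∖ P` has no refuter even against the constant-one algorithm
(Chen et al. Thm. 1.9; tree: `exists_NP_diff_P_without_PRefuter_of_not_NE_subset_ioE`).
Constructivity is a feature of the summit's single-complete-language form, not of `NP ∖ P`.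

References: D. Gutfreund, R. Shaltiel, A. Ta-Shma, Comput. Complexity 16 (2007) 412–441, Thm. 1.1;
L. Chen, C. Jin, R. Santhanam, R. Williams, *Constructive separations and their consequences*,
FOCS 2021 / TheoretiCS 3 (2024) = arXiv:2203.14379, Def. 1.1, Thm. 1.2, Thm. 1.9;
S. Cook, *The P versus NP problem* (Clay, 2000), §1. All ingredients are tree theorems; standard
axioms only.
-/

namespace Summit.PneNP.PneNP.Theorems

open Literature.Computability.Complexity Literature.Computability.MetaComplexity Filter

/-- **The summit ⇔ exact-length `P`-refuters for every length-paddable `NP`-complete language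
against every `P`-language** (Chen–Jin–Santhanam–Williams Thm. 1.2 read as an equivalence; `←`
at the paddable complete language `onesZeroPad SAT`).
[Chen–Jin–Santhanam–Williams 2022, Thm. 1.2; Gutfreund–Shaltiel–Ta-Shma 2007, Thm. 1.1] -/
theorem soloInformed_pneNP_iff_hasPConstructiveSeparation :
    PneNP ↔ ∀ L : Language Bool, IsNPComplete L → IsLengthPaddable L →
      HasPConstructiveSeparation L Classes.P := by
  rw [soloInformed_pneNP_iff_exists_not_mem, ← Set.not_subset]
  exact not_NP_subset_P_iff_hasPConstructiveSeparation isNPComplete_SAT_holds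

/-- **The summit on one language, constructively:** `PneNP ↔` every `D ∈ P` is refuted on
`onesZeroPad SAT = {1ⁱ 0 x : x ∈ SAT}` by a polynomial-time `R` printing, for infinitely many `n`,
an `n`-bit word of `onesZeroPad SAT ∆ D`. [Chen–Jin–Santhanam–Williams 2022, Thm. 1.2, Def. 1.1] -/
theorem soloInformed_pneNP_iff_padSAT_refutable :
    PneNP ↔ HasPConstructiveSeparation (onesZeroPad SAT) Classes.P := by
  rw [soloInformed_pneNP_iff_exists_not_mem, ← Set.not_subset]
  constructor
  · exact fun h => hasPConstructiveSeparation_onesZeroPad h isNPComplete_SAT_holds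
  · intro h hsub
    exact not_mem_of_hasPConstructiveSeparation h
      (hsub (isNPComplete_onesZeroPad isNPComplete_SAT_holds).mem)

/-- **`P ≠ NP` iff every polynomial-time heuristic for `SAT` is efficiently refutable, infinitely
often.** `PneNP ↔ ∀ D ∈ P, ∃ R : ℕ → {0,1}*` computable in time polynomial in `n` from `1ⁿ`, with
`|R n| ≤ n`, such that `R n ∈ SAT ∆ D` for infinitely many `n`. The generator depends on `D`; its
success events are not themselves decidable by it. [Gutfreund–Shaltiel–Ta-Shma 2007, Thm. 1.1;
Chen–Jin–Santhanam–Williams 2022, Thm. 1.2] -/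
theorem soloInformed_pneNP_iff_sat_refutable :
    PneNP ↔ ∀ D ∈ Classes.P, ∃ R : ℕ → List Bool,
      PolyTimeComputable Computability.unaryEncodeNat (id : List Bool → List Bool) R ∧
        (∀ n, (R n).length ≤ n) ∧ ∃ᶠ n in atTop, (R n ∈ SAT ↔ R n ∉ D) := by
  rw [soloInformed_pneNP_iff_exists_not_mem, ← Set.not_subset]
  exact not_NP_subset_P_iff_refuters isNPComplete_SAT_holds

/-- **The two shapes of the obligation, side by side.** `PneNP ↔` for every `D ∈ P`: the set of
inputs on which `D` misclassifies `SAT` is INFINITE (`SoloInformedIOShape`), AND it is hit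
infinitely often by a polynomial-time generator on `1ⁿ` (this file). The first conjunct alone and
the second alone are each already equivalent to the summit. [Cook, Clay §1; Gutfreund–Shaltiel–Ta-Shma 2007, Thm. 1.1] -/
theorem soloInformed_pneNP_iff_sat_errors_infinite_and_constructible :
    PneNP ↔ ∀ D ∈ Classes.P,
      ({x : List Bool | x ∈ SAT ↔ x ∉ D} : Set (List Bool)).Infinite ∧
        ∃ R : ℕ → List Bool,
          PolyTimeComputable Computability.unaryEncodeNat (id : List Bool → List Bool) R ∧
            (∀ n, (R n).length ≤ n) ∧ ∃ᶠ n in atTop, (R n ∈ SAT ↔ R n ∉ D) := by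
  constructor
  · intro h D hD
    exact ⟨soloInformed_pneNP_iff_sat_infinitely_often_wrong.1 h D hD,
      soloInformed_pneNP_iff_sat_refutable.1 h D hD⟩
  · intro h
    exact soloInformed_pneNP_iff_sat_refutable.2 fun D hD => (h D hD).2

end Summit.PneNP.PneNP.Theorems
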